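import Summits.BirchSwinnertonDyer.BirchSwinnertonDyer.Theorems.SignedLowerHalvesSmallImageLowerHalfBothSignsRttKanGoodDepleteConditionOne
import Summits.BirchSwinnertonDyer.BirchSwinnertonDyer.Theorems.SignedLowerHalvesSmallImageLowerHalfBothSignsRttKanDepleteStep
import Literature.NumberTheory.EllipticCurves.CMNewformGamma0LevelSquarefull
import HarnessLib

/-!
# Route `SignedLowerHalves`, crux L `SmallImageLowerHalfBothSigns` (item stmt-BirchSwinnertonDyer-23599), line `rtt_w3`,
# stub Kan₂ `stub_thetaLayerLambda_ns` — brick K2b (part 2): the `S₀`-DEPLETED EIGENFORM of a newform at the EXACT level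
# `M₀·∏_{v∈S₀} ℓ_v^{2 − min(2, v_ℓ(M₀))}`, with Vatsal's Condition 1, its `q`-expansion and its PLUS SYMBOL

Width seat `bsd-line-slh-p3-w3` g11 under LEAD `cruxlead-stmt-BirchSwinnertonDyer-23599` g0 (cell `bsd-ssimc`). ROUTE-INDEPENDENT
helper (`--supports stmt-BirchSwinnertonDyer-23599`); THEOREMS ONLY — no definition, no named fact, no `sorry`; closes nothing;
BSD is not proved by any of this.

WHAT. For a newform `g ∈ S₂(Γ₀(M₀))` and a finite set `S₀` of finite places of `ℚ` (`ℓ_v = natGenerator v`), induction on `S₀`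
(one place at a time; the level is a free variable `L = M₀·∏ ℓ_v^{d_v}`, `d_v = 2 − min(2, v_{ℓ_v}(M₀))`, so that no cusp form
is transported along an equality of levels) builds `G ∈ S₂(Γ₀(L))` with: `G` a normalised Hecke eigenform satisfying VATSAL'S
CONDITION 1, `a_q(G) = a_q(g)` for primes `q ∤ L`, `aₙ(G) = 𝟙[no ℓ_v divides n]·aₙ(g)`, and the plus symbol
`[x]⁺_G = ∑_{k : S₀ → {0,1,2}} (∏_v c_{v,k_v} ℓ_v^{−k_v}) · [x·∏_v ℓ_v^{k_v}]⁺_g`, `c_{v,·}` the coefficients of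
`P_v = 1 − a_{ℓ_v}(g) X + 𝟙_{ℓ_v ∤ M₀} ℓ_v X²` — EXACTLY the depleted plus symbol of `…RttKanLayerDepletionExact`. The step at
`v`: `ℓ ∤ M₀` — the good-prime depletion `ι₁ − a_ℓι_ℓ + ℓι_{ℓ²}` (`…RttKanGoodDeplete{Data,ConditionOne}`, level `×ℓ²`);
`ℓ ∥ M₀` — the depletion `ι₁ − a_ℓι_ℓ` (`a_ℓ = ±1`, cell bsd-addord's `…DepleteConditionOne`, level `×ℓ`); `ℓ² ∣ M₀` — nothing
(`a_ℓ(g) = 0`, Atkin–Lehner). The common level of Kan₂ is this `L` for `M₀ = N_W` and for `M₀ = M` (equal by the level clause).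

* §1 `prod_subtype_insert'`, `sum_piFinset_insert_depletion` — splitting `k : insert v S' → {0,1,2}` as `(k_v, k|S')`.
* §2 ★ `exists_depletedForm`.

References: [AtkinLehner1970] Thm. 3–5; [DiamondShurman2005] Prop. 5.6.2, §5.7, Thm. 5.8.3; [Vatsal1999] (1.2) Condition 1;
[GreenbergVatsal2000] §1 (8); [CremonaAlgorithms1997] §2.4.
-/

set_option autoImplicit false
-- D-0017: single-problem summit, the namespace repeats the problem name by design.
set_option linter.dupNamespace false

noncomputable section

open scoped MatrixGroups ModularForm Classical NNReal

open CongruenceSubgroup Literature.NumberTheory.EllipticCurves Literature.NumberTheory.EllipticCurves.ModularForms Polynomial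
  IsDedekindDomain NumberField Rat.HeightOneSpectrum
open UpperHalfPlane hiding I

namespace Summit.BirchSwinnertonDyer.BirchSwinnertonDyer.Theorems.SmallImageRttKan

open Summit.BirchSwinnertonDyer.BirchSwinnertonDyer.Theorems.KimAtThreeDeepLowerOffStratumLevelLoweringConditionOne
  (hasSimpleHeckeGenEigenspace_of_isNewform0)
open Summit.BirchSwinnertonDyer.BirchSwinnertonDyer.Theorems.KimAtThreeDeepLowerOffStratumLevelLoweringDepleteConditionOne
  (isHeckeEigenform_deplete hasSimpleHeckeGenEigenspace_deplete_of_hasSimpleHeckeGenEigenspace)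
open Summit.BirchSwinnertonDyer.BirchSwinnertonDyer.Theorems.KimAtThreeDeepLowerOffStratumLevelLoweringVatsalStab
  (cuspCoeff_stab isNormalized_stab)
open Summit.BirchSwinnertonDyer.BirchSwinnertonDyer.Theorems.KimAtThreeDeepLowerOffStratumLevelLoweringStabEigenform
  (cuspCoeff_mul_cuspCoeff)

/-! ### §1 Splitting functions on `insert v S'` -/

section Combinatorics

variable {α : Type*} [DecidableEq α] {M : Type*} [CommMonoid M]

/-- `∏_{i ∈ insert a s} G(i) = G(a) · ∏_{i ∈ s} G(i)` for a function on the SUBTYPE `↥(insert a s)` (`a ∉ s`). [folklore] -/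
theorem prod_subtype_insert' {a : α} {s : Finset α} (ha : a ∉ s) (G : ↥(insert a s) → M) :
    ∏ i : ↥(insert a s), G i =
      G ⟨a, Finset.mem_insert_self a s⟩ * ∏ i : ↥s, G ⟨i, Finset.mem_insert_of_mem i.2⟩ := by
  rw [← Fintype.prod_equiv (Finset.subtypeInsertEquivOption ha).symm
      (fun o ↦ G ((Finset.subtypeInsertEquivOption ha).symm o)) G (fun _ ↦ rfl), Fintype.prod_option]
  rfl

/-- **Splitting the depletion sum at a new place.** For `a ∉ s`, coefficients `Φ : α → ℕ → ℂ`, moduli `w : α → ℕ`,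
a function `F : ℚ → ℂ` and `x ∈ ℚ`:
`∑_{k : insert a s → {0,1,2}} (∏_i Φ_i(k_i)) F(x·∏_i w_i^{k_i}) = ∑_{j<3} Φ_a(j) ∑_{k' : s → {0,1,2}} (∏_i Φ_i(k'_i)) F((w_a^j x)·∏_i w_i^{k'_i})`.
[folklore] -/
theorem sum_piFinset_insert_depletion {a : α} {s : Finset α} (ha : a ∉ s) (Φ : α → ℕ → ℂ) (w : α → ℕ) (F : ℚ → ℂ)
    (x : ℚ) :
    ∑ k ∈ Fintype.piFinset (fun _ : ↥(insert a s) ↦ Finset.range 3),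
        (∏ i : ↥(insert a s), Φ i (k i)) * F (x * ((∏ i : ↥(insert a s), w i ^ (k i) : ℕ) : ℚ)) =
      ∑ j ∈ Finset.range 3, Φ a j *
        ∑ k ∈ Fintype.piFinset (fun _ : ↥s ↦ Finset.range 3),
          (∏ i : ↥s, Φ i (k i)) * F (((w a ^ j : ℕ) : ℚ) * x * ((∏ i : ↥s, w i ^ (k i) : ℕ) : ℚ)) := by
  set e := Finset.subtypeInsertEquivOption ha with he
  have hea : e.symm none = ⟨a, Finset.mem_insert_self a s⟩ := rfl
  have hes : ∀ i : ↥s, e.symm (some i) = ⟨i, Finset.mem_insert_of_mem i.2⟩ := fun _ ↦ rfl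
  -- RHS as a sum over `range 3 ×ˢ piFinset`
  rw [Finset.sum_congr rfl fun j _ ↦ Finset.mul_sum _ _ _, ← Finset.sum_product']
  -- the bijection `k ↦ (k a, k|s)`
  have h1 : e ⟨a, Finset.mem_insert_self a s⟩ = none := by
    rw [← hea, Equiv.apply_symm_apply]
  have h2 : ∀ i : ↥s, e ⟨i, Finset.mem_insert_of_mem i.2⟩ = some i := fun i ↦ by
    rw [← hes, Equiv.apply_symm_apply]
  refine Finset.sum_nbij' (fun k ↦ (k ⟨a, Finset.mem_insert_self a s⟩, fun i ↦ k ⟨i, Finset.mem_insert_of_mem i.2⟩))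
    (fun jk ↦ fun i ↦ Option.elim (e i) jk.1 jk.2) ?_ ?_ ?_ ?_ ?_
  · intro k hk
    rw [Fintype.mem_piFinset] at hk
    rw [Finset.mem_product, Fintype.mem_piFinset]
    exact ⟨hk _, fun i ↦ hk _⟩
  · intro jk hjk
    rw [Finset.mem_product, Fintype.mem_piFinset] at hjk
    rw [Fintype.mem_piFinset]
    intro i
    rcases e i with _ | i'
    · exact hjk.1
    · exact hjk.2 i'
  · intro k _
    funext i
    have hi : i = e.symm (e i) := (Equiv.symm_apply_apply e i).symm
    dsimp only
    rcases hei : e i with _ | i'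
    · rw [hei, hea] at hi
      rw [hi]
      rfl
    · rw [hei, hes] at hi
      rw [hi]
      rfl
  · intro jk _
    dsimp only
    refine Prod.ext ?_ (funext fun i' ↦ ?_)
    · rw [h1]; rfl
    · dsimp only
      rw [h2]; rfl
  · intro k _
    dsimp only
    rw [prod_subtype_insert' ha (fun i ↦ Φ i (k i)), prod_subtype_insert' ha (fun i ↦ w i ^ (k i)), Nat.cast_mul,
      mul_assoc (Φ a _)]
    ring_nf

end Combinatorics

/-! ### §2 The depleted eigenform at the exact level -/

section Induction

variable {M₀ : ℕ} [NeZero M₀] {g : CuspForm (Gamma0 M₀) 2} (hg : IsNewform0 g)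
include hg

/-- ★ **The `S₀`-depleted eigenform of a newform, at the exact level, with Vatsal's Condition 1, `q`-expansion and plus symbol.**
Let `g ∈ S₂(Γ₀(M₀))` be a newform and `S₀` a finite set of finite places of `ℚ` (`ℓ_v = natGenerator v`). At the level
`L = M₀·∏_{v∈S₀} ℓ_v^{2 − min(2, v_{ℓ_v}(M₀))}` there is `G ∈ S₂(Γ₀(L))`: a normalised Hecke eigenform with Vatsal's Condition 1,
`a_q(G) = a_q(g)` for primes `q ∤ L`, `aₙ(G) = 0` if some `ℓ_v ∣ n` and `aₙ(g)` otherwise, and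
`[x]⁺_G = ∑_{k : S₀ → {0,1,2}} (∏_v coeff_{k_v}(1 − a_{ℓ_v}(g)X + 𝟙_{ℓ_v∤M₀} ℓ_v X²)·ℓ_v^{−k_v}) · [x·∏_v ℓ_v^{k_v}]⁺_g` for every
`x ∈ ℚ` — the iterated depletion `∏_v P_v(ℓ_v⁻¹[ℓ_v]) g` (Greenberg–Vatsal §1 (8)), one place at a time: good `ℓ` by
`ι₁ − a_ℓι_ℓ + ℓι_{ℓ²}` (`…RttKanGoodDepleteConditionOne`), `ℓ ∥ M₀` by `ι₁ − a_ℓι_ℓ` (cell bsd-addord's `…DepleteConditionOne`,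
`a_ℓ = ±1`), `ℓ² ∣ M₀` untouched (`a_ℓ = 0`). [cite: GreenbergVatsal2000, §1 p. 9 (display (8))] [cite: Vatsal1999, (1.2) Condition 1]
[cite: AtkinLehner1970, Thm. 3 and Thm. 5] [cite: DiamondShurman2005, Prop. 5.6.2 and Thm. 5.8.3] -/
theorem exists_depletedForm (S₀ : Finset (HeightOneSpectrum (𝓞 ℚ))) :
    ∀ (L : ℕ) [NeZero L], L = M₀ * ∏ v ∈ S₀, natGenerator v ^ (2 - min 2 (padicValNat (natGenerator v) M₀)) →
      ∃ G : CuspForm (Gamma0 L) 2,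
        IsHeckeEigenform G ∧ IsNormalized G ∧ HasSimpleHeckeGenEigenspace G ∧
        (∀ q : ℕ, q.Prime → ¬ q ∣ L → cuspCoeff G q = cuspCoeff g q) ∧
        (∀ n : ℕ, cuspCoeff G n = if ∃ v ∈ S₀, natGenerator v ∣ n then 0 else cuspCoeff g n) ∧
        (∀ x : ℚ, plusSymbol G x = ∑ k ∈ Fintype.piFinset (fun _ : ↥S₀ ↦ Finset.range 3),
          (∏ v : ↥S₀, (1 - C (cuspCoeff g (natGenerator (v : HeightOneSpectrum (𝓞 ℚ)))) * X +
              (if natGenerator (v : HeightOneSpectrum (𝓞 ℚ)) ∣ M₀ then 0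
                else C ((natGenerator (v : HeightOneSpectrum (𝓞 ℚ)) : ℂ))) * X ^ 2 : ℂ[X]).coeff (k v) *
            (((natGenerator (v : HeightOneSpectrum (𝓞 ℚ)) : ℂ))⁻¹) ^ (k v)) *
          plusSymbol g (x * ((∏ v : ↥S₀, natGenerator (v : HeightOneSpectrum (𝓞 ℚ)) ^ (k v) : ℕ) : ℚ))) := by
  induction S₀ using Finset.induction_on with
  | empty =>
    intro L _ hL
    rw [Finset.prod_empty, mul_one] at hL
    subst hL
    refine ⟨g, hg.2.1, hg.2.2, hasSimpleHeckeGenEigenspace_of_isNewform0 hg, fun q _ _ ↦ rfl, fun n ↦ ?_, fun x ↦ ?_⟩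
    · simp
    · have huniv : Fintype.piFinset (fun _ : ↥(∅ : Finset (HeightOneSpectrum (𝓞 ℚ))) ↦ Finset.range 3) = Finset.univ := by
        ext k; simp
      rw [huniv, Fintype.sum_unique]
      simp
  | insert v S' hv ih =>
    intro L _ hL
    -- notation and the previous level
    set ℓ : ℕ := natGenerator v with hℓdef
    have hℓ : ℓ.Prime := prime_natGenerator v
    haveI : NeZero ℓ := ⟨hℓ.ne_zero⟩
    set R : ℕ := ∏ w ∈ S', natGenerator w ^ (2 - min 2 (padicValNat (natGenerator w) M₀)) with hRdef
    have hR0 : R ≠ 0 := Finset.prod_ne_zero_iff.mpr fun w _ ↦ pow_ne_zero _ (prime_natGenerator w).ne_zero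
    set L' : ℕ := M₀ * R with hL'def
    haveI : NeZero L' := ⟨mul_ne_zero (NeZero.ne M₀) hR0⟩
    obtain ⟨G', hG'eig, hG'norm, hG'C, hG'q, hG'n, hG'sym⟩ := ih L' rfl
    have hLeq : L = L' * ℓ ^ (2 - min 2 (padicValNat ℓ M₀)) := by
      rw [hL, Finset.prod_insert hv, hL'def, hRdef]; ring
    -- `ℓ` does not divide `R` (distinct places lie over distinct primes)
    have hℓR : ¬ ℓ ∣ R := by
      rw [hRdef]
      intro h
      obtain ⟨w, hw, hdw⟩ := (Nat.Prime.prime hℓ).exists_mem_finset_dvd h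
      have hℓw : ℓ ∣ natGenerator w := (Nat.Prime.prime hℓ).dvd_of_dvd_pow hdw
      have heq : natGenerator v = natGenerator w :=
        (Nat.prime_dvd_prime_iff_eq hℓ (prime_natGenerator w)).mp hℓw
      have hvw : v = w := Rat.HeightOneSpectrum.primesEquiv.injective (Subtype.ext heq)
      exact hv (hvw ▸ hw)
    have hM₀L' : M₀ ∣ L' := Dvd.intro _ rfl
    -- primes not dividing `L'` vs `S'`
    have hS'L' : ∀ w ∈ S', natGenerator w ∣ L' := by
      intro w hw
      by_cases hwM : natGenerator w ∣ M₀
      · exact hwM.trans hM₀L'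
      · have hpv : padicValNat (natGenerator w) M₀ = 0 := padicValNat.eq_zero_of_not_dvd hwM
        have : natGenerator w ^ (2 - min 2 (padicValNat (natGenerator w) M₀)) ∣ R := by
          rw [hRdef]; exact Finset.dvd_prod_of_mem _ hw
        rw [hpv, min_eq_right (Nat.zero_le 2), Nat.sub_zero] at this
        exact ((dvd_pow_self _ two_ne_zero).trans this).trans (Dvd.intro_left _ rfl)
    -- the insert-indexed clauses, from a one-step formula
    have key : ∀ (G : CuspForm (Gamma0 L) 2) (a b : ℂ),
        a = cuspCoeff g ℓ → b = (if ℓ ∣ M₀ then 0 else (ℓ : ℂ)) →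
        (∀ n : ℕ, cuspCoeff G n = if ℓ ∣ n then 0 else cuspCoeff G' n) →
        (∀ x : ℚ, plusSymbol G x = plusSymbol G' x - a / ℓ * plusSymbol G' (ℓ * x) +
          b / ((ℓ : ℂ) * ℓ) * plusSymbol G' ((ℓ * ℓ : ℕ) * x)) →
        (∀ n : ℕ, cuspCoeff G n = if ∃ w ∈ insert v S', natGenerator w ∣ n then 0 else cuspCoeff g n) ∧
        (∀ x : ℚ, plusSymbol G x = ∑ k ∈ Fintype.piFinset (fun _ : ↥(insert v S') ↦ Finset.range 3),
          (∏ w : ↥(insert v S'), (1 - C (cuspCoeff g (natGenerator (w : HeightOneSpectrum (𝓞 ℚ)))) * X +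
              (if natGenerator (w : HeightOneSpectrum (𝓞 ℚ)) ∣ M₀ then 0
                else C ((natGenerator (w : HeightOneSpectrum (𝓞 ℚ)) : ℂ))) * X ^ 2 : ℂ[X]).coeff (k w) *
            (((natGenerator (w : HeightOneSpectrum (𝓞 ℚ)) : ℂ))⁻¹) ^ (k w)) *
          plusSymbol g (x * ((∏ w : ↥(insert v S'), natGenerator (w : HeightOneSpectrum (𝓞 ℚ)) ^ (k w) : ℕ) : ℚ))) := by
      intro G a b ha hb hq hsym
      refine ⟨fun n ↦ ?_, fun x ↦ ?_⟩
      · rw [hq n, hG'n n]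
        by_cases hℓn : ℓ ∣ n
        · rw [if_pos hℓn, if_pos ⟨v, Finset.mem_insert_self v S', hℓn⟩]
        · rw [if_neg hℓn]
          by_cases hex : ∃ w ∈ S', natGenerator w ∣ n
          · obtain ⟨w, hw, hd⟩ := hex
            rw [if_pos ⟨w, hw, hd⟩, if_pos ⟨w, Finset.mem_insert_of_mem hw, hd⟩]
          · rw [if_neg hex, if_neg]
            rintro ⟨w, hw, hd⟩
            rcases Finset.mem_insert.mp hw with rfl | hw'
            · exact hℓn hd
            · exact hex ⟨w, hw', hd⟩
      · rw [sum_piFinset_insert_depletion hv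
          (fun w j ↦ (1 - C (cuspCoeff g (natGenerator w)) * X +
            (if natGenerator w ∣ M₀ then 0 else C ((natGenerator w : ℕ) : ℂ)) * X ^ 2 : ℂ[X]).coeff j *
              (((natGenerator w : ℕ) : ℂ))⁻¹ ^ j)
          (fun w ↦ natGenerator w) (fun y ↦ plusSymbol g y) x]
        simp only [← hG'sym]
        have hC : (if natGenerator v ∣ M₀ then (0 : ℂ[X]) else C ((natGenerator v : ℕ) : ℂ)) = C b := by
          rw [hb, ← hℓdef]; split_ifs <;> simp
        rw [hC, sum_range_three_eulerCoeff, hsym x, ← ha, ← hℓdef]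
        have hℓ0 : (ℓ : ℂ) ≠ 0 := by exact_mod_cast hℓ.ne_zero
        congr 1
        · congr 1
          · simp
          · rw [pow_one]; ring
        · rw [show ℓ ^ 2 = ℓ * ℓ from sq ℓ]; ring
    -- the three cases on `v_ℓ(M₀)`
    by_cases hℓM₀ : ℓ ∣ M₀
    · by_cases hℓ2 : ℓ ^ 2 ∣ M₀
      · -- `ℓ² ∣ M₀`: nothing to do (`a_ℓ(g) = 0`)
        have hpv : 2 ≤ padicValNat ℓ M₀ :=
          (padicValNat_dvd_iff_le (hp := ⟨hℓ⟩) (NeZero.ne M₀)).mp hℓ2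
        have hd : 2 - min 2 (padicValNat ℓ M₀) = 0 := by rw [min_eq_left hpv, Nat.sub_self]
        rw [hd, pow_zero, mul_one] at hLeq
        subst hLeq
        have ha0 : cuspCoeff g ℓ = 0 := hg.cuspCoeff_eq_zero_of_sq_dvd hℓ hℓ2
        have hq : ∀ n : ℕ, cuspCoeff G' n = if ℓ ∣ n then 0 else cuspCoeff G' n := by
          intro n
          by_cases hℓn : ℓ ∣ n
          · rw [if_pos hℓn, hG'n n]
            split_ifs with h
            · rfl
            · obtain ⟨m, rfl⟩ := hℓn
              have R1 := cuspCoeff_mul_cuspCoeff hg.2.1 hg.2.2 hℓ m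
              rw [ha0, zero_mul, if_pos hℓM₀, add_zero] at R1
              exact R1.symm
          · rw [if_neg hℓn]
        obtain ⟨h5, h6⟩ := key G' (cuspCoeff g ℓ) (if ℓ ∣ M₀ then 0 else (ℓ : ℂ)) rfl rfl hq (fun x ↦ by
          rw [ha0, if_pos hℓM₀, zero_div, zero_mul, sub_zero, zero_div, zero_mul, add_zero])
        exact ⟨G', hG'eig, hG'norm, hG'C, hG'q, h5, h6⟩
      · -- `ℓ ∥ M₀`: the depletion `ι₁ − a_ℓ ι_ℓ`, level `L'ℓ`
        have hpv : padicValNat ℓ M₀ = 1 := by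
          have h1 : 1 ≤ padicValNat ℓ M₀ := (padicValNat_dvd_iff_le (hp := ⟨hℓ⟩) (NeZero.ne M₀)).mp (by rwa [pow_one])
          have h2 : ¬ 2 ≤ padicValNat ℓ M₀ := fun h ↦ hℓ2 ((padicValNat_dvd_iff_le (hp := ⟨hℓ⟩) (NeZero.ne M₀)).mpr h)
          omega
        have hd : 2 - min 2 (padicValNat ℓ M₀) = 1 := by rw [hpv]; rfl
        rw [hd, pow_one] at hLeq
        subst hLeq
        have h1 : L' * 1 ∣ L' * ℓ := by rw [mul_one]; exact Dvd.intro ℓ rfl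
        have hℓℓ : L' * ℓ ∣ L' * ℓ := dvd_rfl
        have hℓL' : ℓ ∣ L' := hℓM₀.trans hM₀L'
        have haℓ : cuspCoeff G' ℓ = cuspCoeff g ℓ := by
          rw [hG'n ℓ, if_neg]
          rintro ⟨w, hw, hd⟩
          exact hℓR (((Nat.prime_dvd_prime_iff_eq (prime_natGenerator w) hℓ).mp hd) ▸
            (by rw [hRdef]; exact (dvd_pow_self _ (by
              have := Nat.sub_le 2 (min 2 (padicValNat (natGenerator w) M₀))
              intro h0
              -- exponent `0` would mean `ℓ_w² ∣ M₀`; but then `ℓ_w ∣ M₀`, and `ℓ_w = ℓ`, contradiction with `¬ ℓ² ∣ M₀`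
              have hpw : 2 ≤ padicValNat (natGenerator w) M₀ := by omega
              have : natGenerator w ^ 2 ∣ M₀ := (padicValNat_dvd_iff_le (hp := ⟨prime_natGenerator w⟩) (NeZero.ne M₀)).mpr hpw
              rw [(Nat.prime_dvd_prime_iff_eq (prime_natGenerator w) hℓ).mp hd] at this
              exact hℓ2 this)).trans (Finset.dvd_prod_of_mem _ hw)))
        have hne : cuspCoeff G' ℓ ≠ 0 := by
          rw [haℓ]
          rcases hg.cuspCoeff_eq_one_or_eq_neg_one hℓ hℓM₀ hℓ2 with h | h <;> rw [h] <;> norm_num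
        set G : CuspForm (Gamma0 (L' * ℓ)) 2 :=
          iota L' (L' * ℓ) 1 2 h1 G' - cuspCoeff G' ℓ • iota L' (L' * ℓ) ℓ 2 hℓℓ G' with hGdef
        have hGeig : IsHeckeEigenform G := isHeckeEigenform_deplete h1 hℓℓ hG'eig hG'norm hℓ hℓL'
        have hGnorm : IsNormalized G := isNormalized_stab G' (cuspCoeff G' ℓ) h1 hℓℓ hG'norm hℓ
        have hGC : HasSimpleHeckeGenEigenspace G :=
          hasSimpleHeckeGenEigenspace_deplete_of_hasSimpleHeckeGenEigenspace hg h1 hℓℓ hL'def hG'eig hG'norm hG'C hG'q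
            hℓ hℓM₀ hℓR haℓ hne
        have hq : ∀ n : ℕ, cuspCoeff G n = if ℓ ∣ n then 0 else cuspCoeff G' n :=
          cuspCoeff_levelDeplete_eq h1 hℓℓ hG'eig hG'norm hℓ hℓL'
        obtain ⟨h5, h6⟩ := key G (cuspCoeff g ℓ) (if ℓ ∣ M₀ then 0 else (ℓ : ℂ)) rfl rfl hq (fun x ↦ by
          rw [hGdef, plusSymbol_levelDeplete, haℓ, if_pos hℓM₀, zero_div, zero_mul, add_zero])
        refine ⟨G, hGeig, hGnorm, hGC, fun q hq' hqL ↦ ?_, h5, h6⟩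
        have hqℓ : ¬ ℓ ∣ q := fun h ↦ hqL (((Nat.prime_dvd_prime_iff_eq hℓ hq').mp h) ▸ dvd_mul_left ℓ L')
        rw [hq q, if_neg hqℓ, hG'q q hq' (fun h ↦ hqL (h.mul_right ℓ))]
    · -- `ℓ ∤ M₀`: the good-prime depletion, level `L'ℓ²`
      have hpv : padicValNat ℓ M₀ = 0 := padicValNat.eq_zero_of_not_dvd hℓM₀
      have hd : 2 - min 2 (padicValNat ℓ M₀) = 2 := by rw [hpv]; rfl
      rw [hd, pow_two] at hLeq
      subst hLeq
      have hℓL' : ¬ ℓ ∣ L' := by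
        rw [hL'def]
        intro h
        rcases (Nat.Prime.dvd_mul hℓ).mp h with h' | h'
        · exact hℓM₀ h'
        · exact hℓR h'
      have h1 : L' * 1 ∣ L' * (ℓ * ℓ) := by rw [mul_one]; exact Dvd.intro _ rfl
      have hℓ1 : L' * ℓ ∣ L' * (ℓ * ℓ) := by rw [← mul_assoc]; exact Dvd.intro ℓ rfl
      have hℓ2' : L' * (ℓ * ℓ) ∣ L' * (ℓ * ℓ) := dvd_rfl
      have haℓ : cuspCoeff G' ℓ = cuspCoeff g ℓ := hG'q ℓ hℓ hℓL'
      set G : CuspForm (Gamma0 (L' * (ℓ * ℓ))) 2 :=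
        iota L' (L' * (ℓ * ℓ)) 1 2 h1 G' - cuspCoeff G' ℓ • iota L' (L' * (ℓ * ℓ)) ℓ 2 hℓ1 G' +
          (ℓ : ℂ) • iota L' (L' * (ℓ * ℓ)) (ℓ * ℓ) 2 hℓ2' G' with hGdef
      have hGeig : IsHeckeEigenform G := isHeckeEigenform_goodDeplete h1 hℓ1 hℓ2' hG'eig hG'norm rfl hℓ hℓL'
      have hGnorm : IsNormalized G := isNormalized_goodDeplete h1 hℓ1 hℓ2' hG'norm hℓ _
      have hGC : HasSimpleHeckeGenEigenspace G :=
        hasSimpleHeckeGenEigenspace_goodDeplete_of_hasSimpleHeckeGenEigenspace hg h1 hℓ1 hℓ2' hM₀L' rfl hG'eig hG'norm hG'C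
          hG'q hℓ hℓL'
      have hq : ∀ n : ℕ, cuspCoeff G n = if ℓ ∣ n then 0 else cuspCoeff G' n :=
        cuspCoeff_goodDeplete_eq h1 hℓ1 hℓ2' hG'eig hG'norm rfl hℓ hℓL'
      have hℓ0 : (ℓ : ℂ) ≠ 0 := by exact_mod_cast hℓ.ne_zero
      obtain ⟨h5, h6⟩ := key G (cuspCoeff g ℓ) (if ℓ ∣ M₀ then 0 else (ℓ : ℂ)) rfl rfl hq (fun x ↦ by
        rw [hGdef, plusSymbol_goodDeplete h1 hℓ1 hℓ2' hℓ, haℓ, if_neg hℓM₀]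
        congr 1
        field_simp)
      refine ⟨G, hGeig, hGnorm, hGC, fun q hq' hqL ↦ ?_, h5, h6⟩
      have hqℓ : q ≠ ℓ := fun h ↦ hqL (h ▸ (dvd_mul_right ℓ ℓ).trans (dvd_mul_left _ L'))
      rw [cuspCoeff_goodDeplete_prime h1 hℓ1 hℓ2' hG'norm hℓ hq', if_neg hqℓ, hG'q q hq' (fun h ↦ hqL (h.mul_right _))]

end Induction

end Summit.BirchSwinnertonDyer.BirchSwinnertonDyer.Theorems.SmallImageRttKan

end
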